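import Mathlib
import HarnessLib
import Summits.Ventures.LatticeQCDFlow.Exactness.PopulationLeaveOneOutExact

/-!
# LatticeQCDFlow / Exactness — LEARNING ON THE JOB, IV: ADAPTATION THAT DOES NOT READ THE CHAIN IS EXACT — parameters drawn from a
# schedule, a pilot run, or ANY reference process evolving on its own leave the target invariant at every step, whatever the training rule

HONEST FRAMING: exact (Metropolis-corrected) sampling algorithms for lattice gauge theory;
figures of merit are autocorrelation/cost numbers at stated couplings and volumes; no
continuum-physics claim.

Venture `LatticeQCDFlow` (cell pub-lqcd), topic `Exactness`, FANOUT row 30 (lean-1 GEN-44, theme LEARNING ON THE JOB).  NEW WORK of the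
cell over Mathlib's Giry monad (`Measure.bind`, `Measure.prod`, Tonelli); no definition is introduced, nothing is cited as a fact.  Tree
inputs: `PopulationLeaveOneOutExact` (`leaveOneOut_imh_sections_exact`), `IMHKernel`.  The positive twin of `SelfTunedFlowChoiceBias`:
there the parameter in use was a function of the current configuration; here it is anything that does not read it.  Printed counterparts
NAMED ONLY: the "external adaptation" clause of adaptive MCMC (a parameter sequence fixed in advance or driven by an independent process keeps
`Π` stationary at every step: Roberts–Rosenthal 2007 §2; Brofos–Gabrié–Brubaker–Lederman 2022 §4 for flow proposals), the pilot-run ∕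
two-stage practice of flow samplers for lattice fields (train, freeze, sample).

## Setting (general measurable `Ω`, parameter space `H`)
An ADAPTED UPDATE `κ : Kernel (H × Ω) Ω`: `κ(h, x)` = the law of the next configuration from `x` when the parameters (the flow's weights, a
step size, a mixture coefficient) are `h`.  THE FROZEN-EXACTNESS HYPOTHESIS `hκ`: every section is exact for `π`,
`∫ κ(h, x)(B) π(dx) = π(B)` — e.g. `κ(h, ·) = indepMH (q h) (w h)` with each flow paired with its own weight (`exogenous_imh_sections_exact`).
A PARAMETER PROCESS `L : Kernel H H` (one training step: SGD on stored data, on a pilot run, on reference walkers — anything), which does NOT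
read the configuration.  THE JOINT STEP, def-free: `J(h, x) = L(h) ⊗ κ(h, x)` — the configuration moves with the CURRENT parameters while
the parameters move on their own (hypothesis `hJ`).

## Results (no `sorry`)
* §1 `sectionExact_bind_eq` ∕ `sectionExact_lintegral_eq` — the hypothesis as a measure identity `π.bind κ(h, ·) = π` and in integrated
  form `∫∫ f(y) κ(h, x)(dy) π(dx) = ∫ f dπ`.
* §2 INDEPENDENT PARAMETERS (`exogenous_prod_bind`): if the joint law of (parameters, configuration) is a PRODUCT `ρ_H ⊗ π`, one adapted
  step gives the configuration the law `ρ_H(H)·π` — `π` for a probability `ρ_H` (`exogenous_prod_bind_eq`).  MIXTURES OF PRODUCTS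
  (`exogenous_mixture_bind_eq`): the same if the joint law is `∫ (η(a) ⊗ π) m(da)` for any exogenous `a` — conditionally on something
  that does not involve the configuration, parameters and configuration are independent (a pilot run; a seed; a schedule).
* §3 THE READ-ONLY PARAMETER PROCESS (**`exogenous_step_prod`**): from a product `ρ_H ⊗ π` one joint step lands EXACTLY on the product
  `(ρ_H L) ⊗ π`; hence (**`exogenous_iterate_prod`**) after `t` joint steps the law is `(ρ_H Lᵗ) ⊗ π` and (**`exogenous_iterate_snd`**) the
  configuration's law is `π` AT EVERY TIME, for every parameter dynamics `L` and every initial parameter law — training may run forever,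
  converge or not, as long as it never reads the chain it steers.  `exogenous_step_snd` — one-step form.
* §4 THE FLOW INSTANCE (`exogenous_imh_sections_exact`, **`exogenous_imh_iterate_snd`**): a measurable family of flows `q : Kernel H Ω`
  with jointly measurable positive weights, `w(h, ·)·q(h) = π` for all `h`; the flow sampler driven by any read-only training process is
  exact at every step.
Reading (gauge files): retraining the flow DURING production is exact provided the training data are not the production chain — a pilot
stream, an independent replica, reweighted flow samples (which never touch the chain) — and the production chain uses whatever parameters
are current.  What is NOT covered: training on the production chain itself (`SelfTunedFlowChoiceBias`: biased at lag zero;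
`LaggedAdaptationDoeblin`: the bias decays geometrically in the lag).
-/

namespace Summit.Ventures.LatticeQCDFlow.Exactness

open MeasureTheory ProbabilityTheory
open scoped ENNReal

variable {Ω H : Type*} [MeasurableSpace Ω] [MeasurableSpace H] {π : Measure Ω}

/-! ## §1 The frozen-exactness hypothesis as a measure identity -/

/-- Frozen exactness as `π.bind κ(h, ·) = π`. [ours, bookkeeping] -/
theorem sectionExact_bind_eq (κ : Kernel (H × Ω) Ω)
    (hκ : ∀ (h : H) {B : Set Ω}, MeasurableSet B → ∫⁻ x, κ (h, x) B ∂π = π B) (h : H) :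
    π.bind (κ.comap (Prod.mk h) measurable_prodMk_left) = π := by
  ext B hB
  rw [Measure.bind_apply hB (Kernel.aemeasurable _)]
  simp_rw [Kernel.comap_apply]
  exact hκ h hB

/-- Frozen exactness in integrated form: `∫ (∫ f dκ(h, x)) π(dx) = ∫ f dπ` for measurable `f ≥ 0`. [ours] -/
theorem sectionExact_lintegral_eq (κ : Kernel (H × Ω) Ω)
    (hκ : ∀ (h : H) {B : Set Ω}, MeasurableSet B → ∫⁻ x, κ (h, x) B ∂π = π B) (h : H) {f : Ω → ℝ≥0∞}
    (hf : Measurable f) : ∫⁻ x, ∫⁻ y, f y ∂(κ (h, x)) ∂π = ∫⁻ y, f y ∂π := by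
  have hb := Measure.lintegral_bind (m := π) (Kernel.aemeasurable (κ.comap (Prod.mk h) measurable_prodMk_left))
    (f := f) hf.aemeasurable
  rw [sectionExact_bind_eq κ hκ h] at hb
  simp_rw [Kernel.comap_apply] at hb
  exact hb.symm

/-! ## §2 Independent parameters; mixtures of products -/

/-- **INDEPENDENT PARAMETERS**: from a product law `ρ_H ⊗ π` one adapted step gives the configuration the law `ρ_H(H)·π`. [ours] -/
theorem exogenous_prod_bind [SFinite π] (κ : Kernel (H × Ω) Ω)
    (hκ : ∀ (h : H) {B : Set Ω}, MeasurableSet B → ∫⁻ x, κ (h, x) B ∂π = π B) (ρH : Measure H) [SFinite ρH] :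
    (ρH.prod π).bind κ = ρH Set.univ • π := by
  ext B hB
  rw [Measure.bind_apply hB (Kernel.aemeasurable _), lintegral_prod _ (Kernel.measurable_coe κ hB).aemeasurable,
    Measure.smul_apply, smul_eq_mul]
  simp_rw [hκ _ hB]
  rw [lintegral_const, mul_comm]

/-- … **hence `π` exactly for a probability law of the parameters** — whatever that law (a trained flow's weights after any number of
epochs on exogenous data). [ours] -/
theorem exogenous_prod_bind_eq [SFinite π] (κ : Kernel (H × Ω) Ω)
    (hκ : ∀ (h : H) {B : Set Ω}, MeasurableSet B → ∫⁻ x, κ (h, x) B ∂π = π B) (ρH : Measure H) [IsProbabilityMeasure ρH] :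
    (ρH.prod π).bind κ = π := by
  rw [exogenous_prod_bind κ hκ ρH, measure_univ, one_smul]

/-- **MIXTURES OF PRODUCTS**: if, conditionally on an exogenous variable `a ∼ m`, the parameters have law `η(a)` and the configuration is
an independent `π`-draw — joint law `∫ (η(a) ⊗ π) m(da)` — one adapted step gives the configuration the law `π`. [ours] -/
theorem exogenous_mixture_bind_eq {A : Type*} [MeasurableSpace A] [SFinite π] (κ : Kernel (H × Ω) Ω) [IsMarkovKernel κ]
    (hκ : ∀ (h : H) {B : Set Ω}, MeasurableSet B → ∫⁻ x, κ (h, x) B ∂π = π B) (m : Measure A) [IsProbabilityMeasure m]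
    (η : Kernel A H) [IsMarkovKernel η] :
    (m.bind (η ×ₖ Kernel.const A π)).bind κ = π := by
  rw [Measure.bind_bind (Kernel.aemeasurable _) (Kernel.aemeasurable _)]
  have h : ∀ a, ((η ×ₖ Kernel.const A π) a).bind κ = π := fun a => by
    rw [Kernel.prod_apply, Kernel.const_apply, exogenous_prod_bind_eq κ hκ]
  simp_rw [h]
  rw [Measure.bind_const, measure_univ, one_smul]

/-! ## §3 The read-only parameter process: product in, product out -/

/-- **PRODUCT IN, PRODUCT OUT**: from `ρ_H ⊗ π`, one JOINT step — parameters by `L` (not reading the configuration), configuration by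
`κ` with the current parameters — lands exactly on `(ρ_H L) ⊗ π`. [ours] -/
theorem exogenous_step_prod [SFinite π] (κ : Kernel (H × Ω) Ω) [IsMarkovKernel κ]
    (hκ : ∀ (h : H) {B : Set Ω}, MeasurableSet B → ∫⁻ x, κ (h, x) B ∂π = π B) (L : Kernel H H) [IsMarkovKernel L]
    (J : Kernel (H × Ω) (H × Ω)) (hJ : ∀ (h : H) (x : Ω) {C : Set (H × Ω)}, MeasurableSet C → J (h, x) C = ((L h).prod (κ (h, x))) C)
    (ρH : Measure H) [SFinite ρH] : (ρH.prod π).bind J = (ρH.bind L).prod π := by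
  ext C hC
  rw [Measure.bind_apply hC (Kernel.aemeasurable _), lintegral_prod _ (Kernel.measurable_coe J hC).aemeasurable,
    Measure.prod_apply hC, Measure.lintegral_bind (Kernel.aemeasurable L) (measurable_measure_prodMk_left hC).aemeasurable]
  refine lintegral_congr fun h => ?_
  simp_rw [hJ h _ hC, Measure.prod_apply_symm hC]
  rw [sectionExact_lintegral_eq κ hκ h (measurable_measure_prodMk_right hC), ← Measure.prod_apply_symm hC, Measure.prod_apply hC]

/-- **… AT EVERY TIME**: after `t` joint steps from `ρ_H ⊗ π` the law is `(ρ_H Lᵗ) ⊗ π`. [ours] -/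
theorem exogenous_iterate_prod [SFinite π] (κ : Kernel (H × Ω) Ω) [IsMarkovKernel κ]
    (hκ : ∀ (h : H) {B : Set Ω}, MeasurableSet B → ∫⁻ x, κ (h, x) B ∂π = π B) (L : Kernel H H) [IsMarkovKernel L]
    (J : Kernel (H × Ω) (H × Ω)) (hJ : ∀ (h : H) (x : Ω) {C : Set (H × Ω)}, MeasurableSet C → J (h, x) C = ((L h).prod (κ (h, x))) C) :
    ∀ (t : ℕ) (ρH : Measure H) [IsProbabilityMeasure ρH],
      (fun ρ : Measure (H × Ω) => ρ.bind J)^[t] (ρH.prod π) = ((fun ν : Measure H => ν.bind L)^[t] ρH).prod π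
  | 0, ρH, _ => rfl
  | t + 1, ρH, _ => by
    haveI : IsProbabilityMeasure (ρH.bind L) := by
      constructor
      rw [Measure.bind_apply MeasurableSet.univ (Kernel.aemeasurable _)]
      simp
    rw [Function.iterate_succ_apply, Function.iterate_succ_apply, exogenous_step_prod κ hκ L J hJ ρH]
    exact exogenous_iterate_prod κ hκ L J hJ t (ρH.bind L)

/-- The parameter marginal stays a probability law under the training dynamics. [ours, bookkeeping] -/
theorem exogenous_iterate_isProbability (L : Kernel H H) [IsMarkovKernel L] :
    ∀ (t : ℕ) (ρH : Measure H) [IsProbabilityMeasure ρH], IsProbabilityMeasure ((fun ν : Measure H => ν.bind L)^[t] ρH)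
  | 0, ρH, h => h
  | t + 1, ρH, _ => by
    haveI : IsProbabilityMeasure (ρH.bind L) := by
      constructor
      rw [Measure.bind_apply MeasurableSet.univ (Kernel.aemeasurable _)]
      simp
    rw [Function.iterate_succ_apply]
    exact exogenous_iterate_isProbability L t (ρH.bind L)

/-- **ONE STEP: THE CONFIGURATION'S LAW IS `π`**. [ours] -/
theorem exogenous_step_snd [SFinite π] (κ : Kernel (H × Ω) Ω) [IsMarkovKernel κ]
    (hκ : ∀ (h : H) {B : Set Ω}, MeasurableSet B → ∫⁻ x, κ (h, x) B ∂π = π B) (L : Kernel H H) [IsMarkovKernel L]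
    (J : Kernel (H × Ω) (H × Ω)) (hJ : ∀ (h : H) (x : Ω) {C : Set (H × Ω)}, MeasurableSet C → J (h, x) C = ((L h).prod (κ (h, x))) C)
    (ρH : Measure H) [IsProbabilityMeasure ρH] : ((ρH.prod π).bind J).map Prod.snd = π := by
  haveI : IsProbabilityMeasure (ρH.bind L) := by
    constructor
    rw [Measure.bind_apply MeasurableSet.univ (Kernel.aemeasurable _)]
    simp
  rw [exogenous_step_prod κ hκ L J hJ ρH, Measure.map_snd_prod, measure_univ, one_smul]

/-- **EXOGENOUS ADAPTATION IS EXACT AT EVERY TIME**: for every parameter dynamics `L` that does not read the configuration, every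
initial parameter law, every `t`: after `t` joint steps from `ρ_H ⊗ π` the configuration's law is EXACTLY `π`. [ours] -/
theorem exogenous_iterate_snd [SFinite π] (κ : Kernel (H × Ω) Ω) [IsMarkovKernel κ]
    (hκ : ∀ (h : H) {B : Set Ω}, MeasurableSet B → ∫⁻ x, κ (h, x) B ∂π = π B) (L : Kernel H H) [IsMarkovKernel L]
    (J : Kernel (H × Ω) (H × Ω)) (hJ : ∀ (h : H) (x : Ω) {C : Set (H × Ω)}, MeasurableSet C → J (h, x) C = ((L h).prod (κ (h, x))) C)
    (t : ℕ) (ρH : Measure H) [IsProbabilityMeasure ρH] :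
    ((fun ρ : Measure (H × Ω) => ρ.bind J)^[t] (ρH.prod π)).map Prod.snd = π := by
  haveI := exogenous_iterate_isProbability L t ρH
  rw [exogenous_iterate_prod κ hκ L J hJ t ρH, Measure.map_snd_prod, measure_univ, one_smul]

/-- The joint step exists (the hypothesis `hJ` can be met): `J = (L.comap fst) ×ₖ κ`. [ours, bookkeeping] -/
theorem exogenous_step_exists (κ : Kernel (H × Ω) Ω) [IsMarkovKernel κ] (L : Kernel H H) [IsMarkovKernel L] :
    ∃ J : Kernel (H × Ω) (H × Ω), ∀ (h : H) (x : Ω) {C : Set (H × Ω)}, MeasurableSet C → J (h, x) C = ((L h).prod (κ (h, x))) C := by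
  refine ⟨(L.comap Prod.fst measurable_fst) ×ₖ κ, fun h x C _ => ?_⟩
  rw [Kernel.prod_apply, Kernel.comap_apply]

/-! ## §4 The flow instance -/

section Flow

variable (q : Kernel H Ω) [IsMarkovKernel q] {w : H → Ω → ℝ}

/-- **EVERY FROZEN FLOW SAMPLER IS EXACT**: a measurable family of flows `q(h)` with positive weights `w(h, ·)`, `w(h, ·)·q(h) = π` for all
`h` (each flow with ITS OWN importance weight): any `κ` realising `indepMH (q h) (w h)` section-wise satisfies the frozen-exactness
hypothesis (the tree's `leaveOneOut_imh_sections_exact` with the population replaced by the parameter space). [ours] -/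
theorem exogenous_imh_sections_exact (hw : ∀ h, Measurable (w h)) (hw0 : ∀ h y, 0 < w h y)
    (hπ : ∀ h, ((q h).withDensity fun y => ENNReal.ofReal (w h y)) = π) (κ : Kernel (H × Ω) Ω)
    (hκ : ∀ (h : H) (x : Ω) {B : Set Ω}, MeasurableSet B → κ (h, x) B =
      ∫⁻ y in B, imhAcceptE (w h) x y ∂(q h) + (1 - imhAcceptMass (q h) (w h) x) * B.indicator 1 x)
    (h : H) {B : Set Ω} (hB : MeasurableSet B) : ∫⁻ x, κ (h, x) B ∂π = π B :=
  leaveOneOut_imh_sections_exact q hw hw0 hπ κ hκ h hB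

/-- **THE FLOW SAMPLER DRIVEN BY A READ-ONLY TRAINING PROCESS IS EXACT AT EVERY STEP**: flows retrained by any dynamics `L` on the
parameter space that never reads the production chain; the chain proposes from the current flow with the current flow's importance ratio;
from `ρ_H ⊗ π` the configuration's law after `t` steps is `π`. [ours] -/
theorem exogenous_imh_iterate_snd [SFinite π] (hw : ∀ h, Measurable (w h)) (hw0 : ∀ h y, 0 < w h y)
    (hπ : ∀ h, ((q h).withDensity fun y => ENNReal.ofReal (w h y)) = π) (κ : Kernel (H × Ω) Ω) [IsMarkovKernel κ]
    (hκ : ∀ (h : H) (x : Ω) {B : Set Ω}, MeasurableSet B → κ (h, x) B =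
      ∫⁻ y in B, imhAcceptE (w h) x y ∂(q h) + (1 - imhAcceptMass (q h) (w h) x) * B.indicator 1 x)
    (L : Kernel H H) [IsMarkovKernel L] (J : Kernel (H × Ω) (H × Ω))
    (hJ : ∀ (h : H) (x : Ω) {C : Set (H × Ω)}, MeasurableSet C → J (h, x) C = ((L h).prod (κ (h, x))) C)
    (t : ℕ) (ρH : Measure H) [IsProbabilityMeasure ρH] :
    ((fun ρ : Measure (H × Ω) => ρ.bind J)^[t] (ρH.prod π)).map Prod.snd = π :=
  exogenous_iterate_snd κ (fun h _ hB => exogenous_imh_sections_exact q hw hw0 hπ κ hκ h hB) L J hJ t ρH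

end Flow

end Summit.Ventures.LatticeQCDFlow.Exactness
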